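import Summits.CriticalPhenomena.PercolationContinuityZ3.Theorems.PercNearOneGluingNoHeavyLowerTailHullPortTADefs
import HarnessLib

/-!
# `NoHeavyLowerTail` (stmt-CriticalPhenomena-4575) — conditioned slack hierarchy, level one: definitions

Definitions file (prover `prim-ineq-prove-5`; `--supports stmt-CriticalPhenomena-4575`), in the "same weights, deleted pairs"
bookkeeping of `…HullPortTADefs` (`delE`, `cut`, `avoidEv`).  Objects of prim-hp-8's Lemma U / Lemma Φ (memo
run/shared/lean/prim/prim-hp-8/PROOF-S5-ALL-R.md §3.2–3.3, level `k = 1`): owner `x`, avoided set `Y`, worlds `ω ↦ G − cut_Y(ω)`: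
* `HullPort.covW w Y A F ω` — the covariance of two configuration functionals `A, F` in the world `G − cut_Y(ω)`
  (`HullPort.taC` is the case `A = g(C_s)`, `F = 1{s ↔ y}`);
* `HullPort.wsum w x Y A F = Σ_ω w(ω) 1{x ↮ Y} covW` — the world-averaged covariance on `{x ↮ Y}` (`HullPort.taB` likewise);
* `HullPort.cshPhi w x d Y Ψ C` — hp-8's functional `Φ(K)`, `K = {d} ∪ V(C)` (`C` an edge cluster of `d`, `K̄ = barOf {d} C` the pairs
  meeting `K`): `Φ(K) = E[ 1{x ↮ Y off K} · ( Ψ(C_x off C_Y[off K]) − Ψ(C_x off K) ) ]`, "off K" = delete the pairs `K̄`,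
  `C_Y[off K]` = the open vertex cluster of `Y` off `K` (whose pairs are `cut Y (η ∖ K̄)`; `K` itself is NOT deleted in the first term).
[cite: VandenbergHaggstromKahn2005, §1 pp. 3–5 (induced model on `G − Z`) — bookkeeping]
-/

noncomputable section

namespace Summit.CriticalPhenomena.PercolationContinuityZ3.Theorems

open MeasureTheory Set Literature.Probability.LatticeModels Literature.Probability.Percolation
open scoped Classical

variable {V : Type*}

namespace HullPort

open BHK2006 DecisionTree

section CSH

variable [Fintype V]

/-- `Cov_{G − cut_Y(ω)}(A, F)` for configuration functionals `A, F`. (transcription of the cell memo prim-hp-8 PROOF-S5-ALL-R.md §3.3) [folklore] -/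
def covW (w : Sym2 V → ℝ) (Y : Set V) (A F : Set (Sym2 V) → ℝ) (ω : Set (Sym2 V)) : ℝ :=
  delE w (cut Y ω) (fun η => A η * F η) - delE w (cut Y ω) A * delE w (cut Y ω) F

/-- `Σ_ω w(ω) 1{x ↮ Y}(ω) Cov_{G − cut_Y(ω)}(A, F)` — the world covariance averaged over `{x ↮ Y}` (not normalised).
(transcription of the cell memo prim-hp-8 PROOF-S5-ALL-R.md §3.1, the functional `W`) [folklore] -/
def wsum (w : Sym2 V → ℝ) (x : V) (Y : Set V) (A F : Set (Sym2 V) → ℝ) : ℝ :=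
  ∑ ω, weight w ω * (ind (avoidEv x Y) ω * covW w Y A F ω)

/-- hp-8's `Φ(K)` for `K = {d} ∪ V(C)`: `E[1{x ↮ Y off K} (Ψ(C_x off C_Y[off K]) − Ψ(C_x off K))]`, `K̄ = barOf {d} C`.
(transcription of the cell memo prim-hp-8 PROOF-S5-ALL-R.md §3.2, Lemma Φ) [folklore] -/
def cshPhi (w : Sym2 V → ℝ) (x d : V) (Y : Set V) (Ψ : Set (Sym2 V) → ℝ) (C : Set (Sym2 V)) : ℝ :=
  ∑ η, weight w η * (ind (avoidEv x Y) (η \ barOf {d} C) *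
    (Ψ (openEdgeCluster (η \ cut Y (η \ barOf {d} C)) x) - Ψ (openEdgeCluster (η \ barOf {d} C) x)))

end CSH

end HullPort

end Summit.CriticalPhenomena.PercolationContinuityZ3.Theorems
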